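import Summits.NavierStokesRegularity.NavierStokesRegularity.Theorems.AxisTwistDoorAveragedConeLiouvilleDefs
import Literature.Analysis.FluidPDE.DivFreeDriftPositivityPropagationClassical
import HarnessLib

/-!
# Route `AxisTwistDoor`, crux `AveragedConeLiouville` (stmt-NavierStokesRegularity-26889), line `lrt_shell` v4:
# the registered bridge stub `stub_positivityOfNU : PositivityPropagationFactCOfNU`

The typed Nazarov–Ural'tseva fact `Literature.Analysis.FluidPDE.NazarovUraltseva2011_positivity_propagation`
(propagation of positivity for generalized supersolutions with bounded divergence-free drift; A. I. Nazarov,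
N. N. Ural'tseva, Algebra i Analiz 23:1 (2011) = St. Petersburg Math. J. 23 (2012) 93–115, Cor. 3.2 =
Lei–Ren–Tian arXiv:2501.08976 Lemma 2.5; cite item wi-87110) on `ℝ³` implies the CLOSED-cylinder classical
version `PositivityPropagationFactC` consumed by the flux-decay stub: this is the tree's PROVED classical form
`NazarovUraltseva2011_positivity_propagation.classical` (nsreg-typer g24, `DivFreeDriftPositivityPropagationClassical`,
p623500) up to the shape of two binders (`U` explicit ∀ vs. ∃; the drift `C¹` on `U` vs. on the open cylinder,
`ContDiffOn.mono`).  Width seat ns-in-wu-341 g2 under LEAD ns-atd-p1; proof text after nsreg-typer g24's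
farm-checked scratch (pub/ideators/INBOX.md 2026-08-28T10:05:06Z).
[cite: NazarovUraltseva2011HarnackDivFree, Cor. 3.2; LeiRenTian2025, Lemma 2.5]

WHAT THIS IS NOT: not a statement about Navier–Stokes regularity and not a proof of the Nazarov–Ural'tseva fact
(which stays a NAMED hypothesis of the line); the crux `AveragedConeLiouville`, item 26889 and the summit are OPEN.
-/

noncomputable section

-- the summit and its single sub-problem share the name (CONVENTIONS §1)
set_option linter.dupNamespace false

namespace Summit.NavierStokesRegularity.NavierStokesRegularity.Theorems.AveragedConeLiouville.PositivityOfNU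

open Set Metric
open Literature.Analysis.FluidPDE
open Summit.NavierStokesRegularity.NavierStokesRegularity.Theorems.AxisTwistDoorAveragedConeLiouvilleDefs

/-- **Registered stub `stub_positivityOfNU` of crux 26889 (line `lrt_shell` v4), exact signature
`PositivityPropagationFactCOfNU`:** the typed Nazarov–Ural'tseva fact on `ℝ³` implies the closed-cylinder classical
positivity propagation `PositivityPropagationFactC`.  Proof: the tree's `NazarovUraltseva2011_positivity_propagation.classical`
(`finrank ℝ ℝ³ = 3 ≥ 2`), with the drift's `C¹` regularity restricted from the neighbourhood `U` to the open cylinder.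
[cite: NazarovUraltseva2011HarnackDivFree, Cor. 3.2; LeiRenTian2025, Lemma 2.5 (arXiv:2501.08976)] -/
theorem stub_positivityOfNU : PositivityPropagationFactCOfNU := by
  intro h δ T r Λ hδ hT hr hr1 hΛ
  obtain ⟨β, hβ, H⟩ := h.classical (by simp) δ T r Λ hδ hT hr hr1 hΛ
  refine ⟨β, hβ, fun V b U hU hcyl hV hb => ?_⟩
  exact H V b ⟨U, hU, hcyl, hV⟩
    (hb.mono ((Set.prod_mono Set.Ioo_subset_Icc_self Metric.ball_subset_closedBall).trans hcyl))

end Summit.NavierStokesRegularity.NavierStokesRegularity.Theorems.AveragedConeLiouville.PositivityOfNU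

end
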